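/- EXTRA WIDTH seat `ym-line-cbag-p1-w4` (prover-ym-line-cbag-p1-w4-g13-0), LINE 7b `VolumeComparison` of route `GlueballBandRecursion`,
item ⟨stmt-QuantumFields-22957⟩ (`--supports`, helper; it closes nothing).  CLOSEDNESS BY SUPPORT for the WILSON BOX SYSTEM: non-closed support classes of
the cluster expansion of `log Z(box)` vanish identically on the strong-coupling disc (the width seat w3's free-bond factorisation of `partZ`
fed into `Support.support_sum_eq_zero_of_partZ_eq_mul`), and the one-plaquette logarithm is the same explicit function for every label of
every box.  Def-free. -/
import Summits.QuantumFields.YangMills.Theorems.GlueballBandRecursionSupportTruncation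
import Summits.QuantumFields.YangMills.Theorems.GlueballBandRecursionFreeBondFactorisation

/-!
# Route `GlueballBandRecursion`, LINE 7b: non-closed supports drop out of the expansion of `log Z` of a periodic box

The box plaquette system `S = boxSystem ρ n` of the anisotropic periodic box of sides `n : Fin d → ℕ` (all `> 1`) on `ν = zdHaar d G`
(`PeriodicBoxPlaqSystem`; the thermal boxes of line 7b are `n = ![a,a,a,t]`).  A label set `A` is CLOSED when no member has a PRIVATE bond
(a bond of `p ∈ A` lying in no other `q ∈ A`); written out, never defined.  Results:

* §1 `support_sum_eq_zero_of_private_bond`, `support_sum_eq_zero_of_not_closed` — **non-closed supports vanish**: for `A` with `2 ≤ #A`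
  and a private bond, the support sum `ψ(A)(z) = Σ_{𝒞 ⊆ 𝒫(A), ⋃𝒞 = A} Φ^T(𝒞)` of `Support.pertLogZ_eq_sum_support` is `0` on the closed
  disc `‖z‖ ≤ r` (`r M_ρ ≤ 1`, `e(2M_ρ r)(16d²+1)² ≤ 1/2`), by `Support.support_sum_eq_zero_of_partZ_eq_mul` and the width seat w3's free-bond
  factorisation `FreeBond.partZ_eq_partZ_singleton_mul` (`partZ B = partZ {p} · partZ (B.erase p)` for a bond of `p` private in `B`).
* §2 `pertLogZ_singleton_eq_log` — **the one-plaquette logarithm**: on the disc, `log Z({p})(z) = Complex.log (c(z))` for every label `p`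
  of every box (principal branch: `‖c(z) − 1‖ ≤ 2‖z‖M_ρ ≤ 1/2`), hence label- and VOLUME-independent; `sum_support_card_eq_one`: the
  singleton part of the support expansion is `#labels · log c(z)`.
* §3 `support_sum_eq_zero_or_le_card`, `norm_pertLogZ_sub_sum_closed_support_le_rate` — the truncation of `Support.norm_pertLogZ_sub_sum_support_le_rate` SPECIALISED to the
  box: for any smallness predicate `Q` with «closed ∧ connected ∧ ¬Q ⇒ m ≤ #A» (the slab count), on the rate-`τ` disc
  `‖log Z(W)(z) − Σ_{A ⊆ W, #A = 1 ∨ (closed A ∧ connected A ∧ Q A)} ψ(A)(z)‖ ≤ #W · e^{−τ m}`.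

What remains for the LEAD's stub `Thermal.ThermalFreeEnergyVolumeJets` after this file: the slab count (C2: closed connected supports of the
box `![a,a,a,t]`, `a,t ≥ 4`, have `#A ≥ 4 × (spatial extent)`), the rooting/lifting of small closed connected supports across spatial volumes
(C3), and the passage `t → ∞` for the tube rate (the bound of §4 is explicit and linear in `#W = 6a³t`).

HONEST FRAMING.  Plumbing for the ∃-window strong-coupling RECORD rung; nothing here proves the volume comparison, item 22957, the rung
`ColdDoublingRecursionStrongCoupling`, or the Yang–Mills mass gap / the summit `YangMills`.
-/

set_option autoImplicit false

noncomputable section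

open MeasureTheory Finset Filter Topology
open Literature.Probability.LatticeModels
open Literature.MathematicalPhysics.QuantumFieldTheory

namespace Summit.QuantumFields.YangMills.Theorems.GlueballBandRecursion.Support

variable {d : ℕ} {n : Fin d → ℕ} {G : Type*} [Group G] [TopologicalSpace G] [IsTopologicalGroup G] [CompactSpace G]
  [MeasurableSpace G] [BorelSpace G] {N : ℕ} (ρ : G →* Matrix (Fin N) (Fin N) ℂ)

/-! ## §1 Non-closed supports vanish -/

/-- **A support class with a private bond vanishes.**  Box of sides `> 1`; `A` a label set with `2 ≤ #A` and a member `p` owning a bond `e`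
private in `A`.  Then on the closed disc `‖z‖ ≤ r` (`r M_ρ ≤ 1`, `e(2M_ρ r)(boxDeg d + 1)² ≤ 1/2`) the support sum of `A` in the cluster
expansion of `log Z` is zero: `Σ_{𝒞 ⊆ 𝒫(A), ⋃𝒞 = A} Φ^T(𝒞)(z) = 0`. -/
theorem support_sum_eq_zero_of_private_bond (hρ : Continuous ρ) (hn : ∀ i, 1 < n i) {r : ℝ} (hrM : r * costBound ρ ≤ 1)
    (hsmall : Real.exp 1 * (2 * costBound ρ * r) * ((boxDeg d : ℝ) + 1) ^ 2 ≤ 1 / 2)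
    {A : Finset (BoxLabel n)} {p : BoxLabel n} (hpA : p ∈ A) (hA : 2 ≤ A.card) {e : ZdEdge d} (he : e ∈ p.bonds)
    (hfree : ∀ q ∈ A, q ≠ p → e ∉ q.bonds) {z : ℂ} (hz : ‖z‖ ≤ r) :
    ∑ 𝒞 ∈ (rconnSubsets (boxSystem (G := G) ρ n).Adj A).powerset with 𝒞.biUnion id = A,
        truncatedWeight (GeomInc (boxSystem (G := G) ρ n).Adj)
          (connActivity (boxSystem (G := G) ρ n).Adj (zdHaar d G) ((boxSystem (G := G) ρ n).weight z)) 𝒞 = 0 :=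
  support_sum_eq_zero_of_partZ_eq_mul (boxSystem_regular (d := d) (G := G) ρ hρ n) hrM hsmall hpA hA
    (fun _ hBA hpB w _ => FreeBond.partZ_eq_partZ_singleton_mul ρ hρ hn hpB he
      (fun q hq hqp => hfree q (hBA hq) hqp) w) hz

/-- **Non-closed supports vanish** (the same with the closedness predicate written as a hypothesis): if NOT every bond of every member of
`A` lies in another member of `A`, and `2 ≤ #A`, then the support sum of `A` is zero on the disc. -/
theorem support_sum_eq_zero_of_not_closed (hρ : Continuous ρ) (hn : ∀ i, 1 < n i) {r : ℝ} (hrM : r * costBound ρ ≤ 1)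
    (hsmall : Real.exp 1 * (2 * costBound ρ * r) * ((boxDeg d : ℝ) + 1) ^ 2 ≤ 1 / 2)
    {A : Finset (BoxLabel n)} (hA : 2 ≤ A.card)
    (hnc : ¬ ∀ p ∈ A, ∀ e ∈ p.bonds, ∃ q ∈ A, q ≠ p ∧ e ∈ q.bonds) {z : ℂ} (hz : ‖z‖ ≤ r) :
    ∑ 𝒞 ∈ (rconnSubsets (boxSystem (G := G) ρ n).Adj A).powerset with 𝒞.biUnion id = A,
        truncatedWeight (GeomInc (boxSystem (G := G) ρ n).Adj)
          (connActivity (boxSystem (G := G) ρ n).Adj (zdHaar d G) ((boxSystem (G := G) ρ n).weight z)) 𝒞 = 0 := by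
  push Not at hnc
  obtain ⟨p, hpA, e, he, hfree⟩ := hnc
  exact support_sum_eq_zero_of_private_bond ρ hρ hn hrM hsmall hpA hA he (fun q hq hqp => hfree q hq hqp) hz

/-! ## §2 The one-plaquette logarithm is explicit and volume-independent -/

/-- **The one-plaquette logarithm.**  On the disc `‖z‖ ≤ r` (`r M_ρ ≤ 1`, `e(2M_ρ r)(boxDeg d + 1)² ≤ 1/2`), for every label `p` of every
box of sides `> 1`: `log Z({p})(z) = Complex.log (∫_G e^{−z(N − Re tr ρ h)} dh)` — the Kotecký–Preiss logarithm of the one-label system is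
the principal logarithm of the single-plaquette normaliser `c(z)` (`‖c(z) − 1‖ ≤ 2‖z‖M_ρ < 1` keeps `c` in the slit plane; both sides are
continuous logarithms of `c` on the disc vanishing at `0`).  In particular it depends neither on `p` nor on the box. -/
theorem pertLogZ_singleton_eq_log (hρ : Continuous ρ) (hn : ∀ i, 1 < n i) {r : ℝ} (hrM : r * costBound ρ ≤ 1)
    (hsmall : Real.exp 1 * (2 * costBound ρ * r) * ((boxDeg d : ℝ) + 1) ^ 2 ≤ 1 / 2) (p : BoxLabel n) {z : ℂ} (hz : ‖z‖ ≤ r) :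
    pertLogZ (zdHaar d G) ((boxSystem (G := G) ρ n).weight z) (boxSystem (G := G) ρ n).Adj {p} =
      Complex.log (∫ h, Complex.exp (-(z * (((N : ℝ) - (ρ h).trace.re : ℝ) : ℂ))) ∂haarProbability G) := by
  have hR := boxSystem_regular (d := d) (G := G) ρ hρ n
  have hM := costBound_pos ρ
  set c : ℂ → ℂ := fun w => ∫ h, Complex.exp (-(w * (((N : ℝ) - (ρ h).trace.re : ℝ) : ℂ))) ∂haarProbability G with hc
  -- on the disc, `c` stays within `1/2·(D+1)^{-2} ≤ 1/2` of `1`, inside the slit plane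
  have hsmallr : 2 * costBound ρ * r ≤ 1 / 2 := by
    have h1' : (1 : ℝ) ≤ Real.exp 1 := by have := Real.add_one_le_exp (1 : ℝ); linarith
    have h2 : (1 : ℝ) ≤ ((boxDeg d : ℝ) + 1) ^ 2 := by
      have : (1 : ℝ) ≤ (boxDeg d : ℝ) + 1 := by have := Nat.cast_nonneg (α := ℝ) (boxDeg d); linarith
      nlinarith
    have h3 : 0 ≤ 2 * costBound ρ * r := by
      by_contra h
      push Not at h
      have : r * costBound ρ < 0 := by nlinarith
      -- then `‖z‖ ≤ r < 0`, impossible unless vacuous; but `r < 0` contradicts `0 ≤ ‖z‖ ≤ r`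
      have hr : r < 0 := by nlinarith
      exact absurd ((norm_nonneg z).trans hz) (not_le.2 hr)
    nlinarith [mul_le_mul h1' h2 zero_le_one (by positivity : (0:ℝ) ≤ Real.exp 1)]
  have hslit : ∀ w : ℂ, ‖w‖ ≤ r → c w ∈ Complex.slitPlane := by
    intro w hw
    have hwM : ‖w‖ * costBound ρ ≤ 1 := le_trans (by gcongr) hrM
    have h := FreeBond.norm_integral_exp_sub_one_le ρ hρ hwM
    have hcw : c w = 1 + (c w - 1) := by ring
    rw [hcw]
    refine Complex.mem_slitPlane_of_norm_lt_one ?_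
    calc ‖c w - 1‖ ≤ 2 * (‖w‖ * costBound ρ) := h
      _ ≤ 2 * (r * costBound ρ) := by gcongr
      _ = 2 * costBound ρ * r := by ring
      _ < 1 := by linarith
  have hcdiff : Differentiable ℂ c := FreeBond.differentiable_integral_exp ρ hρ hn p
  set φ : ℂ → ℂ := fun w => pertLogZ (zdHaar d G) ((boxSystem (G := G) ρ n).weight w) (boxSystem (G := G) ρ n).Adj {p} -
    Complex.log (c w) with hφ
  have hcont : ContinuousOn φ (Metric.closedBall 0 r) := by
    refine (PlaqSystem.continuousOn_pertLogZ hR hrM hsmall {p}).sub ?_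
    refine ContinuousOn.clog hcdiff.continuous.continuousOn fun w hw => hslit w ?_
    rwa [Metric.mem_closedBall, dist_zero_right] at hw
  have hexp : ∀ w ∈ Metric.closedBall (0 : ℂ) r, Complex.exp (φ w) = 1 := by
    intro w hw
    rw [Metric.mem_closedBall, dist_zero_right] at hw
    obtain ⟨hwM, hwsmall⟩ := disc_of_norm_le hR hrM hsmall hw
    have hcw : c w ≠ 0 := Complex.slitPlane_ne_zero (hslit w hw)
    simp only [hφ, Complex.exp_sub, PlaqSystem.exp_pertLogZ_eq_partZ hR hwM hwsmall, Complex.exp_log hcw,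
      FreeBond.partZ_singleton ρ hρ hn p w]
    exact div_self hcw
  have h0 : φ 0 = 0 := by
    simp only [hφ, pertLogZ_weight_zero, hc, zero_mul, neg_zero, Complex.exp_zero, integral_const, probReal_univ, one_smul,
      Complex.log_one, sub_zero]
  have hzK : z ∈ Metric.closedBall (0 : ℂ) r := by rwa [Metric.mem_closedBall, dist_zero_right]
  have := eq_zero_of_cexp_eq_one hcont hexp h0 hzK
  simp only [hφ] at this
  exact sub_eq_zero.1 this

/-- **The singleton part of the support expansion is `#W · log c(z)`** on the disc: every one-label class contributes the same explicit
one-plaquette logarithm. -/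
theorem sum_support_card_eq_one (hρ : Continuous ρ) (hn : ∀ i, 1 < n i) {r : ℝ} (hrM : r * costBound ρ ≤ 1)
    (hsmall : Real.exp 1 * (2 * costBound ρ * r) * ((boxDeg d : ℝ) + 1) ^ 2 ≤ 1 / 2) (W : Finset (BoxLabel n)) {z : ℂ}
    (hz : ‖z‖ ≤ r) :
    ∑ A ∈ W.powerset with A.card = 1,
        ∑ 𝒞 ∈ (rconnSubsets (boxSystem (G := G) ρ n).Adj A).powerset with 𝒞.biUnion id = A,
          truncatedWeight (GeomInc (boxSystem (G := G) ρ n).Adj)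
            (connActivity (boxSystem (G := G) ρ n).Adj (zdHaar d G) ((boxSystem (G := G) ρ n).weight z)) 𝒞 =
      (W.card : ℂ) * Complex.log (∫ h, Complex.exp (-(z * (((N : ℝ) - (ρ h).trace.re : ℝ) : ℂ))) ∂haarProbability G) := by
  -- the one-element subsets of `W` are the singletons `{p}`, `p ∈ W`
  have hset : (W.powerset.filter fun A => A.card = 1) = W.image fun p => ({p} : Finset (BoxLabel n)) := by
    ext A
    simp only [Finset.mem_filter, Finset.mem_powerset, Finset.mem_image, Finset.card_eq_one]
    constructor
    · rintro ⟨hAW, p, rfl⟩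
      exact ⟨p, hAW (Finset.mem_singleton_self p), rfl⟩
    · rintro ⟨p, hpW, rfl⟩
      exact ⟨Finset.singleton_subset_iff.2 hpW, p, rfl⟩
  rw [hset, Finset.sum_image fun p _ q _ h => Finset.singleton_injective h]
  simp_rw [support_sum_singleton, pertLogZ_singleton_eq_log ρ hρ hn hrM hsmall _ hz]
  rw [Finset.sum_const, nsmul_eq_mul]

/-! ## §3 The closedness-aware truncation, specialised to the box -/

/-- **The «vanish or large» alternative for the box system.**  Box of sides `> 1`, `Q` any predicate on label sets («small») and `m : ℕ`
with «closed ∧ connected ∧ ¬small ⇒ `m ≤ #A`» on the subsets of `W` (the slab count).  Then on the Dobrushin disc every connected `A ⊆ W`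
with `2 ≤ #A` which is not (closed ∧ small) has vanishing support sum or `m ≤ #A` — the hypothesis `hP` of
`Support.norm_pertLogZ_sub_sum_support_le_rate` for the kept family `P A := closed A ∧ connected A ∧ Q A`. -/
theorem support_sum_eq_zero_or_le_card (hρ : Continuous ρ) (hn : ∀ i, 1 < n i) {z : ℂ} (hzM : ‖z‖ * costBound ρ ≤ 1)
    (hsmall : Real.exp 1 * (2 * costBound ρ * ‖z‖) * ((boxDeg d : ℝ) + 1) ^ 2 ≤ 1 / 2) (W : Finset (BoxLabel n))
    (Q : Finset (BoxLabel n) → Prop) (m : ℕ)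
    (hbig : ∀ A ⊆ W, (∀ p ∈ A, ∀ e ∈ p.bonds, ∃ q ∈ A, q ≠ p ∧ e ∈ q.bonds) →
      IsRConnected (boxSystem (G := G) ρ n).Adj A → ¬ Q A → m ≤ A.card)
    (A : Finset (BoxLabel n)) (hAW : A ⊆ W) (hA : 2 ≤ A.card) (hconn : IsRConnected (boxSystem (G := G) ρ n).Adj A)
    (hnot : ¬ ((∀ p ∈ A, ∀ e ∈ p.bonds, ∃ q ∈ A, q ≠ p ∧ e ∈ q.bonds) ∧ Q A)) :
    (∑ 𝒞 ∈ (rconnSubsets (boxSystem (G := G) ρ n).Adj A).powerset with 𝒞.biUnion id = A,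
        truncatedWeight (GeomInc (boxSystem (G := G) ρ n).Adj)
          (connActivity (boxSystem (G := G) ρ n).Adj (zdHaar d G) ((boxSystem (G := G) ρ n).weight z)) 𝒞) = 0 ∨
      m ≤ A.card := by
  by_cases hcl : ∀ p ∈ A, ∀ e ∈ p.bonds, ∃ q ∈ A, q ≠ p ∧ e ∈ q.bonds
  · exact Or.inr (hbig A hAW hcl hconn fun hQ => hnot ⟨hcl, hQ⟩)
  · exact Or.inl (support_sum_eq_zero_of_not_closed ρ hρ hn (r := ‖z‖) hzM hsmall hA hcl le_rfl)

open scoped Classical in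
/-- **Closedness-aware truncation of `log Z` of a periodic box by support.**  Box of sides `> 1`; `Q` any predicate on label sets («small»,
e.g. every spatial extent `≤ a − 2`) and `m : ℕ` such that every CLOSED, `Adj`-connected, non-small `A ⊆ W` has `m ≤ #A` (the slab count).
Then on the rate-`τ` disc `‖z‖M_ρ ≤ 1`, `e^{1+τ}(2M_ρ‖z‖)(boxDeg d + 1)² ≤ 1/2`, `τ ≥ 0`:
`‖log Z(W)(z) − Σ_{A ⊆ W, #A = 1 ∨ (closed A ∧ connected A ∧ Q A)} ψ(A)(z)‖ ≤ #W · e^{−τ m}` —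
the non-closed classes vanish (§2) and the wide closed connected ones sit in the rate-tracking tail (classical decidability of the kept family). -/
theorem norm_pertLogZ_sub_sum_closed_support_le_rate (hρ : Continuous ρ) (hn : ∀ i, 1 < n i) {z : ℂ}
    (hzM : ‖z‖ * costBound ρ ≤ 1) {τ : ℝ} (hτ : 0 ≤ τ)
    (hsmall : Real.exp (1 + τ) * (2 * costBound ρ * ‖z‖) * ((boxDeg d : ℝ) + 1) ^ 2 ≤ 1 / 2) (W : Finset (BoxLabel n))
    (Q : Finset (BoxLabel n) → Prop) (m : ℕ)
    (hbig : ∀ A ⊆ W, (∀ p ∈ A, ∀ e ∈ p.bonds, ∃ q ∈ A, q ≠ p ∧ e ∈ q.bonds) →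
      IsRConnected (boxSystem (G := G) ρ n).Adj A → ¬ Q A → m ≤ A.card) :
    ‖pertLogZ (zdHaar d G) ((boxSystem (G := G) ρ n).weight z) (boxSystem (G := G) ρ n).Adj W -
        ∑ A ∈ W.powerset with (A.card = 1 ∨ ((∀ p ∈ A, ∀ e ∈ p.bonds, ∃ q ∈ A, q ≠ p ∧ e ∈ q.bonds) ∧
            IsRConnected (boxSystem (G := G) ρ n).Adj A ∧ Q A)),
          ∑ 𝒞 ∈ (rconnSubsets (boxSystem (G := G) ρ n).Adj A).powerset with 𝒞.biUnion id = A,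
            truncatedWeight (GeomInc (boxSystem (G := G) ρ n).Adj)
              (connActivity (boxSystem (G := G) ρ n).Adj (zdHaar d G) ((boxSystem (G := G) ρ n).weight z)) 𝒞‖ ≤
      W.card * Real.exp (-(τ * m)) := by
  have hR := boxSystem_regular (d := d) (G := G) ρ hρ n
  have hε : 0 ≤ 2 * costBound ρ * ‖z‖ := by have := costBound_pos ρ; positivity
  have hsmall1 := smallness_one_of_rate (D := boxDeg d) hε hτ hsmall
  exact norm_pertLogZ_sub_sum_support_le_rate hR hzM hτ hsmall W
    (fun A => (∀ p ∈ A, ∀ e ∈ p.bonds, ∃ q ∈ A, q ≠ p ∧ e ∈ q.bonds) ∧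
      IsRConnected (boxSystem (G := G) ρ n).Adj A ∧ Q A) m
    fun A hAW hA2 hconn hnot => support_sum_eq_zero_or_le_card ρ hρ hn hzM hsmall1 W Q m hbig A hAW hA2 hconn
      fun h => hnot ⟨h.1, hconn, h.2⟩

end Summit.QuantumFields.YangMills.Theorems.GlueballBandRecursion.Support

end
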